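import Literature.AnabelianGeometry.AbsoluteAnabelian.AbsTopII.InertiaGroupsLogPoints
import Literature.AnabelianGeometry.AbsoluteAnabelian.AbsTopII.InertiaDecompositionBranch

/-!
# [AbsTopII] Prop 1.3 (x) for a family of log points (`Prop_1_3_x''`) at SMOOTH-CURVE-SHAPE data: the closer

S. Mochizuki, *Topics in Absolute Anabelian Geometry II* [AbsTopII] (bib `MochizukiAbsTopII2013`;
locators = PDF pages of the kurims manuscript `paper:url-585b8d0ad0d9`), §1, Prop 1.3 (x) p. 12 (log
points `τ_S ∈ X^{log}(S^{log})`, their sections `τ_I : I → Π_I`: "if `τ_I` is non-verticial and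
non-edge-like, then the image of `τ_S` is the unique cusp `e_τ` … such that `τ_I(I) ⊆ D_{e_τ}`"; "`τ_I(I) =
I_{v_τ}` … if and only if the image of `τ_S` is a non-nodal point of the irreducible component `v_τ`"; the
node clause).

PROOF-ONLY (no definition), abc-iut-L4-t6 lineage (typer of record of the v3 typing
`DPSCIndexData.Prop_1_3_x''` / `LogPointData.Prop13x`, `AbsTopII/InertiaGroupsLogPoints.lean` p436561),
cell row «P13x″-SMOOTH-SHAPE».  The v3 typing is a predicate on abstract DPSC data TOGETHER WITH a family
`pt : L → X.LogPointData` of labelled sections supplied by the model; its only inhabited instance so far had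
`I = 1` (abc-iut-w5-d197's tripod, where every clause is idle).  Here, at data of SMOOTH-CURVE SHAPE (no
node, one vertex `v`, `Π_v = Π_𝔾`) we CLOSE the predicate for the family one expects from a smooth curve
over a log point: the verticial section `I_v` labelled "non-nodal point of `v`", and, for each cusp `c`, a
section `S_c ⊆ Π_c · I_v` different from `I_v` labelled "the cusp `c`" (the section of a log point mapping
to the cusp: its inertia image twists `I` into `Π_c`).  Inputs (all printed-type, as in the (iii)/(viii′)
closers): [CombGC] Prop 1.2 (ii) for the cusps (commensurable terminality in `Π_𝔾`), MALNORMALITY of the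
cusp groups in `Π_𝔾`, "`I_v · Π_𝔾 = Π_I`", "`I_v ∩ Π_𝔾 = 1`", `I_v ≠ 1`.

* `exists_family_prop_1_3_x''_of_smoothCurveShape` — there is a family `pt : X.Vert ⊕ X.Cusp → X.LogPointData`
  realising EVERY vertex-kind and EVERY cusp-kind, whose cusp points ARE non-verticial and non-edge-like
  (so clause 1 of (x) fires at them, clause 2 at the smooth point — nothing idle), with `X.Prop_1_3_x'' pt`.
  Key steps: `γ·I_v·γ⁻¹ = I_v` for all `γ ∈ Π_H` (`I_v = Z_{Π_I}(Π_𝔾)`, `Π_𝔾`, `Π_I` normal); two sections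
  of `Π_I ↠ I` one inside the other coincide; `S_c ⊆ γD_{e′}γ⁻¹` forces the `Π_c`-part of an element of
  `S_c ∖ I_v` into `N(γΠ_{e′}γ⁻¹) ∩ Π_𝔾 = γΠ_{e′}γ⁻¹`, whence `c = e′` by malnormality.
The model instance (abc-iut-f-066's smooth-curve model, `Σ = {l}`, `S_c` = graph of `Ẑ^{l} ≅ I ⥲ Π_c`) is
the companion `AbsTopII/Prop13xSmoothCurveModel.lean`.  HONEST FRAMING: classical group theory over
abstract DPSC data; inputs are named hypotheses; typed ≠ proved beyond them; nothing here bears on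
[IUTchIII] Cor 3.12.
-/

open scoped Pointwise

universe u

namespace Literature.AnabelianGeometry.AbsoluteAnabelian.AbsTopII.DPSCIndexData

variable (X : DPSCIndexData.{u})

/-! ## Group-theoretic steps -/

/-- Conjugation commutes with centralisers: `g·Z(H)·g⁻¹ = Z(g·H·g⁻¹)`. [cite: MochizukiAbsTopII2013, Prop 1.3 (v) proof p.16] -/
theorem conj_smul_centralizer_eq {G : Type u} [Group G] (g : G) (H : Subgroup G) :
    MulAut.conj g • Subgroup.centralizer (H : Set G) =
      Subgroup.centralizer ((MulAut.conj g • H : Subgroup G) : Set G) := by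
  ext x
  rw [Subgroup.mem_smul_pointwise_iff_exists]
  constructor
  · rintro ⟨z, hz, rfl⟩
    rw [Subgroup.mem_centralizer_iff]
    intro y hy
    rw [SetLike.mem_coe, Subgroup.mem_smul_pointwise_iff_exists] at hy
    obtain ⟨h, hh, rfl⟩ := hy
    have := Subgroup.mem_centralizer_iff.mp hz h hh
    simp only [MulAut.smul_def, MulAut.conj_apply]
    rw [show g * h * g⁻¹ * (g * z * g⁻¹) = g * (h * z) * g⁻¹ by group,
      show g * z * g⁻¹ * (g * h * g⁻¹) = g * (z * h) * g⁻¹ by group, this]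
  · intro hx
    refine ⟨g⁻¹ * x * g, ?_, by simp [MulAut.smul_def, MulAut.conj_apply, mul_assoc]⟩
    rw [Subgroup.mem_centralizer_iff]
    intro h hh
    have hgh : g * h * g⁻¹ ∈ (MulAut.conj g • H : Subgroup G) := by
      rw [Subgroup.mem_smul_pointwise_iff_exists]
      exact ⟨h, hh, rfl⟩
    have := Subgroup.mem_centralizer_iff.mp hx _ hgh
    -- `(g h g⁻¹) x = x (g h g⁻¹)` ⇒ `h (g⁻¹ x g) = (g⁻¹ x g) h`
    have key : g⁻¹ * (g * h * g⁻¹ * x) * g = g⁻¹ * (x * (g * h * g⁻¹)) * g := by rw [this]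
    have lhs : g⁻¹ * (g * h * g⁻¹ * x) * g = h * (g⁻¹ * x * g) := by group
    have rhs : g⁻¹ * (x * (g * h * g⁻¹)) * g = g⁻¹ * x * g * h := by group
    rw [lhs, rhs] at key
    exact key

/-- At smooth-curve shape (`Π_v = Π_𝔾`), the vertex inertia group `I_v = Z_{Π_I}(Π_𝔾)` is stable under
EVERY conjugation of `Π_H` (`Π_𝔾`, `Π_I` are normal). [cite: MochizukiAbsTopII2013, Prop 1.3 (v) p.12] -/
theorem conj_smul_Iv_eq_of_vertSub_eq_PiG (hvs : ∀ v, X.vertSub v = X.PiG) (v : X.Vert) (g : X.PiH) :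
    MulAut.conj g • X.Iv v = X.Iv v := by
  haveI : X.PiG.Normal := X.normal_PiG
  haveI : X.PiI.Normal := X.normal_PiI
  change MulAut.conj g • (Subgroup.centralizer (X.vertSub v : Set X.PiH) ⊓ X.PiI) =
    Subgroup.centralizer (X.vertSub v : Set X.PiH) ⊓ X.PiI
  rw [Subgroup.smul_inf, hvs v, conj_smul_centralizer_eq, Subgroup.Normal.conj_smul_eq_self,
    Subgroup.Normal.conj_smul_eq_self]

/-- Two sections of `Π_I ↠ I = Π_I/Π_𝔾`, one inside the other, coincide: if `S ≤ T`, `T ≤ S·Π_𝔾` and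
`T ∩ Π_𝔾 = 1` then `S = T`. [cite: MochizukiAbsTopII2013, Prop 1.3 (x) p.12] -/
theorem eq_of_le_of_sections {S T : Subgroup X.PiH} (hST : S ≤ T) (hT : T ≤ S ⊔ X.PiG)
    (hTG : T ⊓ X.PiG = ⊥) : S = T := by
  haveI : X.PiG.Normal := X.normal_PiG
  refine le_antisymm hST fun t ht => ?_
  have ht' : t ∈ ((S ⊔ X.PiG : Subgroup X.PiH) : Set X.PiH) := hT ht
  rw [Subgroup.mul_normal] at ht'
  obtain ⟨s, hs, g, hg, rfl⟩ := Set.mem_mul.mp ht'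
  have hgT : g ∈ T := by
    have := T.mul_mem (T.inv_mem (hST hs)) ht
    rwa [inv_mul_cancel_left] at this
  have hg1 : g = 1 := by
    have : g ∈ T ⊓ X.PiG := ⟨hgT, hg⟩
    rw [hTG] at this
    exact this
  rw [hg1, mul_one]
  exact hs

/-! ## The closer -/

/-- **[AbsTopII] Prop 1.3 (x) (v3 typing `Prop_1_3_x''`) at SMOOTH-CURVE-SHAPE data, for the family
"verticial section at the vertex, twisted sections at the cusps".**  Hypotheses: no node, one vertex,
`Π_v = Π_𝔾`; cusps commensurably terminal in `Π_𝔾` ([CombGC] Prop 1.2 (ii)); malnormality of the cusp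
groups in `Π_𝔾`; `I_v · Π_𝔾 = Π_I`, `I_v ∩ Π_𝔾 = 1`, `I_v` closed and `≠ 1`; and for each cusp `c` a closed
section `S_c` of `Π_I ↠ I` inside `Π_c · I_v` (`S_c ∩ Π_𝔾 = 1`, `S_c · Π_𝔾 = Π_I`, every element a product
`k·t`, `k ∈ Π_c`, `t ∈ I_v`) with `S_c ≠ I_v`.  Conclusion: the family `pt : X.Vert ⊕ X.Cusp → LogPointData`
(`I_v` labelled smooth, `S_c` labelled cusp `c`) realises every kind, its cusp points are non-verticial and
non-edge-like, and `Prop_1_3_x''` HOLDS for it. [cite: MochizukiAbsTopII2013, Prop 1.3 (x) p.12] -/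
theorem exists_family_prop_1_3_x''_of_smoothCurveShape [IsEmpty X.Node]
    (hV : ∀ v w : X.Vert, v = w) (hvs : ∀ v, X.vertSub v = X.PiG)
    (hCTc : ∀ e : X.Cusp, IsCommensurablyTerminal ((X.cuspSub e).subgroupOf X.PiG))
    (hmal : ∀ (c c' : X.Cusp) (γ : X.PiH), γ ∈ X.PiG →
      X.cuspSub c ⊓ MulAut.conj γ • X.cuspSub c' ≠ ⊥ → c = c')
    (hsurj : ∀ v, X.Iv v ⊔ X.PiG = X.PiI) (hIG : ∀ v, X.Iv v ⊓ X.PiG = ⊥)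
    (hIcl : ∀ v, IsClosed (X.Iv v : Set X.PiH)) (hIne : ∀ v, X.Iv v ≠ ⊥)
    (S : X.Cusp → Subgroup X.PiH) (hScl : ∀ c, IsClosed (S c : Set X.PiH))
    (hSprod : ∀ c, ∀ s ∈ S c, ∃ k ∈ X.cuspSub c, ∃ t ∈ X.Iv (X.cuspVert c), k * t = s)
    (hSG : ∀ c, S c ⊓ X.PiG = ⊥) (hSsup : ∀ c, S c ⊔ X.PiG = X.PiI)
    (hSne : ∀ c, S c ≠ X.Iv (X.cuspVert c)) :
    ∃ pt : X.Vert ⊕ X.Cusp → X.LogPointData,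
      (∀ v, (pt (Sum.inl v)).kind = PointKind.smooth v ∧ (pt (Sum.inl v)).image = X.Iv v) ∧
      (∀ c, (pt (Sum.inr c)).kind = PointKind.cusp c ∧ (pt (Sum.inr c)).image = S c ∧
        (pt (Sum.inr c)).IsNonVerticial ∧ (pt (Sum.inr c)).IsNonEdgeLike) ∧
      X.Prop_1_3_x'' pt := by
  haveI : X.PiG.Normal := X.normal_PiG
  -- the family
  let pt : X.Vert ⊕ X.Cusp → X.LogPointData := fun l =>
    match l with
    | Sum.inl v =>
      { image := X.Iv v, image_le := inf_le_right, isClosed_image := hIcl v,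
        image_inf := hIG v, image_sup := hsurj v, kind := PointKind.smooth v }
    | Sum.inr c =>
      { image := S c, image_le := by rw [← hSsup c]; exact le_sup_left, isClosed_image := hScl c,
        image_inf := hSG c, image_sup := hSsup c, kind := PointKind.cusp c }
  -- `I_v` normalises every subgroup of `Π_𝔾` (it centralises `Π_𝔾 = Π_v`)
  have hIZ : ∀ v, X.Iv v ≤ Subgroup.centralizer (X.PiG : Set X.PiH) := by
    intro v x hx
    have := hx.1
    rwa [hvs v] at this
  have hIN : ∀ (v) (B : Subgroup X.PiH), B ≤ X.PiG → X.Iv v ≤ Subgroup.normalizer (B : Set X.PiH) :=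
    fun v B hB => le_trans (le_trans (hIZ v) (Subgroup.centralizer_le hB))
      (Subgroup.centralizer_le_normalizer _)
  -- an element of `S_c` outside `I_v`, with non-trivial `Π_c`-part
  have hSex : ∀ c, ∃ s ∈ S c, ∃ k ∈ X.cuspSub c, ∃ t ∈ X.Iv (X.cuspVert c), k * t = s ∧ k ≠ 1 := by
    intro c
    by_contra hcon
    have hcon' : ∀ s ∈ S c, ∀ k ∈ X.cuspSub c, ∀ t ∈ X.Iv (X.cuspVert c), k * t = s → k = 1 := by
      intro s hs k hk t ht hkt
      by_contra hk1
      exact hcon ⟨s, hs, k, hk, t, ht, hkt, hk1⟩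
    -- then `S c ≤ I_v`, hence `S c = I_v`
    have hle : S c ≤ X.Iv (X.cuspVert c) := by
      intro s hs
      obtain ⟨k, hk, t, ht, rfl⟩ := hSprod c s hs
      have hk1 : k = 1 := hcon' (k * t) hs k hk t ht rfl
      rw [hk1, one_mul]
      exact ht
    exact hSne c (X.eq_of_le_of_sections hle
      (by rw [hSsup c, ← hsurj (X.cuspVert c)]; exact le_sup_left) (hIG _))
  -- the cusp points are non-verticial …
  have hNV : ∀ c, (pt (Sum.inr c)).IsNonVerticial := by
    intro c v g hle
    change S c ≤ MulAut.conj g • X.Iv v at hle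
    rw [X.conj_smul_Iv_eq_of_vertSub_eq_PiG hvs, hV v (X.cuspVert c)] at hle
    exact hSne c (X.eq_of_le_of_sections hle
      (by rw [hSsup c, ← hsurj (X.cuspVert c)]; exact le_sup_left) (hIG _))
  -- … and non-edge-like
  have hNE : ∀ c, (pt (Sum.inr c)).IsNonEdgeLike := by
    intro c e g hle
    change S c ≤ MulAut.conj g • X.IEdge e at hle
    rcases e with n | e'
    · exact isEmptyElim n
    · -- `S c ≤ g Π_{e'} g⁻¹ ≤ Π_𝔾` contradicts `S c ∩ Π_𝔾 = 1`, `S c · Π_𝔾 = Π_I ⊋ Π_𝔾`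
      have hleG : S c ≤ X.PiG := by
        refine le_trans hle ?_
        rw [← Subgroup.Normal.conj_smul_eq_self g X.PiG]
        exact Subgroup.pointwise_smul_le_pointwise_smul_iff.mpr (X.cuspSub_le e')
      have hSbot : S c = ⊥ := by rw [← hSG c]; exact (inf_eq_left.mpr hleG).symm
      have hI : X.Iv (X.cuspVert c) ≤ X.PiG := by
        have h1 : X.Iv (X.cuspVert c) ≤ X.PiI := inf_le_right
        rw [← hSsup c, hSbot, bot_sup_eq] at h1
        exact h1
      exact hIne _ (by rw [← hIG (X.cuspVert c)]; exact (inf_eq_left.mpr hI).symm)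
  refine ⟨pt, fun v => ⟨rfl, rfl⟩, fun c => ⟨rfl, rfl, hNV c, hNE c⟩, ?_⟩
  -- `Prop_1_3_x''`: every member satisfies the printed clauses
  intro l
  rcases l with v | c
  · -- the smooth point of `v`: clause 1 idle (verticial), clause 2 by `γ = 1`
    refine ⟨fun hnv _ => ?_, fun _ => ⟨fun v' => ?_, fun e => isEmptyElim e⟩⟩
    · exact absurd (by change X.Iv v ≤ MulAut.conj 1 • X.Iv v; rw [map_one, one_smul]) (hnv v 1)
    · obtain rfl : v' = v := hV v' v
      refine ⟨fun _ => rfl, fun _ => ⟨1, X.PiG.one_mem, ?_⟩⟩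
      change X.Iv v' = MulAut.conj 1 • X.Iv v'
      rw [map_one, one_smul]
  · -- the cusp point of `c`: clause 2 idle (it IS a cusp), clause 1 genuine
    refine ⟨fun _ _ => ⟨c, rfl, fun e' => ⟨?_, ?_⟩⟩, fun hk => absurd rfl (hk c)⟩
    · -- `S c ≤ γ D_{e'} γ⁻¹` ⇒ `e' = c`
      rintro ⟨γ, hγ, hle⟩
      change S c ≤ MulAut.conj γ • X.DvCusp e' at hle
      set B : Subgroup X.PiH := MulAut.conj γ • X.cuspSub e' with hB
      have hNBeq : MulAut.conj γ • X.DvCusp e' = Subgroup.normalizer (B : Set X.PiH) :=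
        X.conj_DEdge_eq_normalizer (Sum.inr e') γ
      have hBle : B ≤ X.PiG := by
        rw [hB, ← Subgroup.conj_smul_eq_self_of_mem hγ]
        exact Subgroup.pointwise_smul_le_pointwise_smul_iff.mpr (X.cuspSub_le e')
      have hNA' : Subgroup.normalizer (X.cuspSub e' : Set X.PiH) ⊓ X.PiG = X.cuspSub e' :=
        normalizer_inf_eq_of_ctIn (X.cuspSub_le e')
          ((isCommensurablyTerminal_subgroupOf_iff (X.cuspSub_le e')).mp (hCTc e'))
      have hNB : Subgroup.normalizer (B : Set X.PiH) ⊓ X.PiG = B := by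
        have h1 : Subgroup.normalizer (B : Set X.PiH) =
            MulAut.conj γ • Subgroup.normalizer (X.cuspSub e' : Set X.PiH) := by
          rw [← hNBeq]; rfl
        rw [h1]
        nth_rewrite 1 [← Subgroup.conj_smul_eq_self_of_mem hγ]
        rw [← Subgroup.smul_inf, hNA']
      obtain ⟨s, hs, k, hk, t, ht, rfl, hk1⟩ := hSex c
      -- `k = (k t) t⁻¹` normalises `B` and lies in `Π_𝔾`, hence in `B`
      have hkN : k ∈ Subgroup.normalizer (B : Set X.PiH) := by
        have hsN : k * t ∈ Subgroup.normalizer (B : Set X.PiH) := by rw [← hNBeq]; exact hle hs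
        have htN : t ∈ Subgroup.normalizer (B : Set X.PiH) := hIN _ B hBle ht
        have := Subgroup.mul_mem _ hsN (Subgroup.inv_mem _ htN)
        rwa [mul_inv_cancel_right] at this
      have hkB : k ∈ B := hNB.le ⟨hkN, X.cuspSub_le c hk⟩
      symm
      refine hmal c e' γ hγ fun hbot => hk1 ?_
      have : k ∈ X.cuspSub c ⊓ B := ⟨hk, hkB⟩
      rw [hbot] at this
      exact this
    · -- `e' = c` ⇒ `S c ≤ D_c` (`γ = 1`): `S c ≤ Π_c · I_v ≤ N(Π_c)`
      rintro rfl
      refine ⟨1, X.PiG.one_mem, ?_⟩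
      change S e' ≤ MulAut.conj 1 • X.DvCusp e'
      rw [map_one, one_smul]
      intro s hs
      obtain ⟨k, hk, t, ht, rfl⟩ := hSprod e' s hs
      exact Subgroup.mul_mem _ (Subgroup.le_normalizer hk) (hIN _ _ (X.cuspSub_le e') ht)

end Literature.AnabelianGeometry.AbsoluteAnabelian.AbsTopII.DPSCIndexData
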